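import Literature.IUT.HodgeArakelov.StableCurveAgreementOfCoverModel
import Literature.IUT.HodgeArakelov.PlusMinusTowerCoverModelAPI
import Literature.IUT.HodgeArakelov.LabelClassesOfCuspsCor24iiiProofs
import HarnessLib

/-!
# [IUTchII] Cor 2.4 (ii) (a), sub-node (a.2) "`D_t ⊆ Π^tp_{Ÿ̲_v}`" AT THE GENUINE `±`-TOWER `PlusMinusTower.ofCoverModel`:
# the tower binders REMOVED — (a.2) reduced to one statement inside `Π^tp_X ↪ Π^tp_C`

S. Mochizuki, *Inter-universal Teichmüller Theory II*, kurims manuscript (Dec. 2020), §2, Cor. 2.4 (ii)(a) p. 70 l. 34–42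
(«`D^δ_t := N_{Π^δ_v}(I^δ_t) ⊆ Π^δ_{v□̈}`», p. 69 «`Π_{v□̈} := Π_{v□} ∩ Π^tp_{Ÿ̲_v}`»); Prop. 2.1 (c)(d) pp. 64–65; Def. 2.3 (i)(ii) pp. 67–68;
Mochizuki, *The étale theta function …* [EtTh], §1 PRIMS pp. 13, 17 (`Y_N → Y`, `Ÿ = Y₂`, `K̈ = K₂`).
[cite: Mochizuki2012, II Cor 2.4 (ii) p.70] (D-0012 claim key, status disputed; bookkeeping over landed constructions; nothing of the
series is asserted).

PROOF-ONLY companion (abc-iut cell, W6-TRANCHE-2 row d069 = cone node `IUTchII:Cor2.4(ii)`, seat abc-iut-w6-d069; sub-DAG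
`plan/L6/SUBDAG-IUTchII-Cor-24.md` row Cor-24.ii.r6, GAP-LEDGER G-w6d069-1) of abc-iut-L6-t19's B14 tower `PlusMinusTower.ofCoverModel`
(p430122; API p430xxx `PlusMinusTowerCoverModelAPI`) and abc-iut-w5-d132's B13-GENUINE cusp family
(`exists_stableCurveAgreement_ofCoverModel`, whose CHARACTERISATION of the cuspidal inertia groups is taken here as the hypothesis
`hchar`, verbatim).  No definition; landed files are not edited.

WHAT IS PROVED.
* `map_YddL_ofCoverModel` — at the genuine tower the target of (a.2), the image of `Π^tp_{Ÿ̲_v} ⊆ Π_v` in `Π̂^cor_v = Q`, IS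
  `ι(inclX(Π^tp_Ÿ ∩ Π^tp_X̲̲))` (`M.GtpYdd ⊓ C.Huu` of the [EtTh] setting): the reference identifications `refIso`/`plainIso` of the
  Prop. 2.1 output `T` and the field `map_plainIso_Ydd` unwound (`refYdd = Π^tp_Ÿ ∩ Π^tp_X̲` by construction of
  `BadPlaceSetting.ofUnderline`).
* `cuspDecomp_one_le_map_YddL_ofCoverModel_of_piTemp` — the binder `hYdd` of every landed closer of the node
  (`cor24_ii_iii'_of_inputs`, …, `cor24_ii_iii'_of_levels_byName`) AT THE GENUINE TOWER, for the cuspidal-inertia datum `Cu` of the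
  B13-GENUINE characterisation, FOLLOWS from ONE statement (`hX`) phrased entirely inside `Π^tp_X ↪ Π^tp_C` of the [EtTh] μ₂-setting
  `M` — «an element `n₀ ∈ Π^tp_X̲̲` whose image normalises, relative to `inclX(Π^tp_X̲̲)`, a `Π^tp_X̲`-conjugate of
  `g·inclX(I_x)·g⁻¹ ∩ inclX(Π^tp_X̲)` (`x` a cusp of `X`, `g ∈ Π^tp_C`) lies in `Π^tp_Ÿ`» — with the profinite completion `ι`, the
  augmentation `Φ`, the Prop. 2.1 output `T` and its chosen identifications, and the relative normaliser in `Q` all ELIMINATED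
  (`ι` injective; `Π_v`, `Π^±_v` computed by abc-iut-L6-t19's API).  This is the L6 half of the «merge obligation» of row Cor-24.ii.r6.
* **`piTemp_hX_of_cuspClauses`** — the [EtTh]/[SemiAnbd] half: `hX` PROVED from three NAMED inputs at `X = M.toTemperedCurve`, taken as
  hypotheses BY NAME: the instance forms of [SemiAnbd] Thm. 6.5 (ii) «`D_x = C_{Π^temp}(H)` for every open `H ⊆ I_x`»
  (`DecompEqCommensuratorOfOpenInertia`, FACT-LIST F-1708 `TemperedDecompositionGroupsHolds`) and Thm. 6.5 (iii) «isomorphisms of tempered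
  groups preserve cuspidal geometric decomposition groups» (`IsoPreservesCuspidalDecomp`, F-1704 `CuspidalAbsolutenessHolds`), and the
  cusp-splitting clause «`D_x ⊆ Π^tp_{Y₂}` (= `Π^tp_Ÿ`, `K = K̈`)» of GAP-LEDGER G-w6d069-1 ([EtTh] §1 PRIMS p. 13: `Y_N → Y` is the covering
  cut out by the cusp section on `G_{K_N}`; p. 17 `Ÿ = Y₂`).  Group theory: `Π^tp_X̲̲ ⊴ Π^tp_X̲`, cuspidal absoluteness for the automorphism
  `conjX g`, the normalised subgroup `γ·I_{x'}·γ⁻¹ ∩ Π^tp_X̲̲` is OPEN in the cuspidal inertia group (`Π^tp_X̲̲` open), commensurator = `D_{x'}`,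
  `Π^tp_Ÿ ⊴ Π^tp_X`.
* **`cuspDecomp_one_le_map_YddL_ofCoverModel`** — ASSEMBLY: the binder `hYdd` AT THE GENUINE TOWER from exactly {F-1704 instance, F-1708
  instance, G-w6d069-1 clause}; together with abc-iut-w5-d184's (a.1) (`cuspDecomp_one_le_box_of_cor24_i`, from node Cor. 2.4 (i) + (S) +
  (E)) clause (a) of Cor. 2.4 (ii) has, at the genuine tower, NO anonymous binder left.
Nothing here takes a side on [IUTchIII] Cor. 3.12; typed ≠ discharged; the three named inputs are hypotheses, not assertions.
-/

noncomputable section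

namespace Literature.IUT.HodgeArakelov

open Literature.AnabelianGeometry.EtaleTheta Literature.AnabelianGeometry.SemiGraphs
open scoped Pointwise

section Conj

variable {G G' : Type*} [Group G] [Group G']

/-- Conjugation by `1` is the identity on subgroups. [folklore] -/
private theorem map_conj_one'' (K : Subgroup G) : K.map (MulAut.conj (1 : G)).toMonoidHom = K := by
  ext y
  rw [Subgroup.mem_map_equiv, MulAut.conj_symm_apply, inv_one, one_mul, mul_one]

/-- A homomorphism intertwines conjugation: `f(t K t⁻¹) = f(t) f(K) f(t)⁻¹`. [folklore] -/
private theorem map_conj_smul (f : G →* G') (t : G) (K : Subgroup G) :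
    (MulAut.conj t • K).map f = MulAut.conj (f t) • K.map f := by
  ext y
  simp only [Subgroup.mem_map, Subgroup.mem_smul_pointwise_iff_exists, MulAut.smul_def, MulAut.conj_apply]
  constructor
  · rintro ⟨x, ⟨s, hs, rfl⟩, rfl⟩
    exact ⟨f s, ⟨s, hs, rfl⟩, by rw [map_mul, map_mul, map_inv]⟩
  · rintro ⟨_, ⟨s, hs, rfl⟩, rfl⟩
    exact ⟨t * s * t⁻¹, ⟨s, hs, rfl⟩, by rw [map_mul, map_mul, map_inv]⟩

end Conj

section ConjTop

variable {G : Type*} [Group G] [TopologicalSpace G] [IsTopologicalGroup G]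

/-- Conjugates of an open subgroup are open. [folklore] -/
private theorem isOpen_conjAct_smul (γ : ConjAct G) {S : Subgroup G} (hS : IsOpen (S : Set G)) :
    IsOpen ((γ • S : Subgroup G) : Set G) := by
  have hset : ((γ • S : Subgroup G) : Set G) =
      (fun y => ConjAct.ofConjAct γ⁻¹ * y * (ConjAct.ofConjAct γ⁻¹)⁻¹) ⁻¹' (S : Set G) := by
    ext y
    rw [SetLike.mem_coe, Subgroup.mem_pointwise_smul_iff_inv_smul_mem, Set.mem_preimage, SetLike.mem_coe,
      ConjAct.smul_def]
  rw [hset]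
  exact hS.preimage ((continuous_const.mul continuous_id).mul continuous_const)

end ConjTop

namespace PlusMinusTower

variable {p : ℕ} [Fact p.Prime] {M : MuTwoSetting p} (e : M.CLevelData)
  {E : M.toThetaSetting.EtaleThetaData} {l : ℕ} (C : E.DoubleUnderline l) {N : ℕ+}
  (μ : M.toThetaSetting.CyclotomeMod l N) (hC : M.toThetaSetting.Compat) (hS : M.toThetaSetting.Sec2Hyps)
  (hl : l.Prime) (hp2 : p ≠ 2) (hpl : p ≠ l) (hζ : ∃ ζ : M.toThetaSetting.K, IsPrimitiveRoot ζ (4 * l))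
  {η : (C.thetaEnvData μ hC hS).PiYdd → MuN p N} (hη : η ∈ (C.thetaEnvData μ hC hS).thetaCocycles)
  {Q : Type} [Group Q] [TopologicalSpace Q] [IsTopologicalGroup Q]
  (ι : M.GtpC →ₜ* Q) (hι : IsProfiniteCompletion ι) (hinj : Function.Injective ι)
  (Φ : Q →* GQp p) (hΦ : ∀ g : M.GtpC, Φ (ι g) = e.augC g) (hΦK : Φ.range = M.GK)
  (hZ : Thm16Sub.KerToZIsCompactlyGenerated M.toThetaSetting) (hN : (C.Huu.subgroupOf (M.GtpXu l)).Normal)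
  {P : TopGroup.{0}} (T : TemperedCoverings (BadPlaceSetting.ofUnderline C μ hC hS hl hp2 hpl hζ hη) P)

/-- Membership in `Π^tp_{Ÿ̲_v} ⊆ P` of a Prop. 2.1 output over `BadPlaceSetting.ofUnderline`, through the chosen reference
identification `refIso : P ≃ Π^tp_X̲̲`: `x ∈ Π^tp_{Ÿ̲_v} ↔ refIso x ∈ Π^tp_Ÿ` (fields `corresponds`/`map_plainIso_Ydd`,
`refYdd := Π^tp_Ÿ ∩ Π^tp_X̲`). ([IUTchII] Prop 2.1 (d), kurims p.65) [claim: Mochizuki2012, status: disputed] -/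
theorem mem_YddL_iff_refIso (x : P) : x ∈ T.YddL ↔ (T.refIso x).1 ∈ M.GtpYdd := by
  change T.incl x ∈ T.Ydd ↔ _
  have h1 : T.incl x ∈ T.Ydd ↔
      T.plainIso (T.incl x) ∈ (BadPlaceSetting.ofUnderline C μ hC hS hl hp2 hpl hζ hη).refYdd := by
    rw [← T.map_plainIso_Ydd]
    constructor
    · intro h
      exact ⟨T.incl x, h, rfl⟩
    · rintro ⟨y, hy, hyx⟩
      have : y = T.incl x := T.plainIso.injective hyx
      exact this ▸ hy
  rw [h1, T.plainIso_incl]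
  rfl

/-- **The target of (a.2) at the genuine tower.**  For `W := PlusMinusTower.ofCoverModel …` over a Prop. 2.1 output `T`, the image of
`Π^tp_{Ÿ̲_v} ⊆ Π_v` in `Π̂^cor_v = Q` (the right-hand side of the binder `hYdd` of the node's closers) IS `ι(inclX(Π^tp_Ÿ ∩ Π^tp_X̲̲))`.
PROVED (unwinding `coverModelEmb_comp_incl`, `refIso`, `map_plainIso_Ydd`). ([IUTchII] Prop 2.1 (d) / Def 2.3 (i), kurims pp.65, 67)
[claim: Mochizuki2012, status: disputed] -/
theorem map_YddL_ofCoverModel :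
    (T.YddL).map ((ofCoverModel e C μ hC hS hl hp2 hpl hζ hη ι hι hinj Φ hΦ hΦK hZ hN T).emb.comp T.incl) =
      ((M.GtpYdd ⊓ C.Huu).map M.inclX).map ι.toMonoidHom := by
  have hemb : (ofCoverModel e C μ hC hS hl hp2 hpl hζ hη ι hι hinj Φ hΦ hΦK hZ hN T).emb.comp T.incl =
      ((ι.toMonoidHom.comp M.inclX).comp C.Huu.subtype).comp (T.refIso.toMulEquiv.toMonoidHom : P →* C.Huu) :=
    coverModelEmb_comp_incl C μ hC hS hl hp2 hpl hζ hη ι T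
  rw [hemb]
  ext q
  constructor
  · rintro ⟨x, hx, rfl⟩
    have hx' := (mem_YddL_iff_refIso C μ hC hS hl hp2 hpl hζ hη T x).mp hx
    exact ⟨M.inclX (T.refIso x).1, ⟨(T.refIso x).1, ⟨hx', (T.refIso x).2⟩, rfl⟩, rfl⟩
  · rintro ⟨_, ⟨y, ⟨hyY, hyH⟩, rfl⟩, rfl⟩
    refine ⟨T.refIso.symm (⟨y, hyH⟩ : C.Huu), ?_, ?_⟩
    · refine (mem_YddL_iff_refIso C μ hC hS hl hp2 hpl hζ hη T _).mpr ?_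
      rw [ContinuousMulEquiv.apply_symm_apply]
      exact hyY
    · change ι (M.inclX (T.refIso (T.refIso.symm (⟨y, hyH⟩ : C.Huu))).1) = ι (M.inclX y)
      rw [ContinuousMulEquiv.apply_symm_apply]

/-- **IUTchII:Cor2.4(ii)** (a), sub-node **(a.2) "`D_t ⊆ Π^tp_{Ÿ̲_v}`" AT THE GENUINE `±`-TOWER, REDUCED TO `Π^tp_X ↪ Π^tp_C`**
(kurims p. 70 l. 34–42).  Let `Cu` be a cuspidal-inertia datum on `W := ofCoverModel …` with abc-iut-w5-d132's B13-GENUINE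
characterisation `hchar` (the cuspidal inertia groups at level `Π_□` are the `J ⊆ Π_□` of the form `t·ι(g·inclX(I_x)·g⁻¹ ∩ inclX(Π^tp_X̲))·t⁻¹`,
`x` a cusp of `X`, `g ∈ Π^tp_C`, `t ∈ Π^±_v`).  Suppose (`hX`, the [EtTh]/[SemiAnbd]-side statement, derived from named inputs in `piTemp_hX_of_cuspClauses` below): whenever
`n₀ ∈ Π^tp_X̲̲` and `inclX n₀` normalises `t₁·(g·inclX(I_x)·g⁻¹ ∩ inclX(Π^tp_X̲))·t₁⁻¹` relative to `inclX(Π^tp_X̲̲)` (`t₁ ∈ inclX(Π^tp_X̲)`), then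
`n₀ ∈ Π^tp_Ÿ`.  THEN the binder `hYdd` of the node's closers holds at `W` for every `Π_{v□} = H`: `D_t = N_{Π_v}(I_t) ⊆` the image of
`Π^tp_{Ÿ̲_v}`, for every `Cu`-cuspidal `I_t ⊆ Δ_{v□}`.  PROVED (`ι` injective; `Π_v = ι(inclX Π^tp_X̲̲)`, `Π^±_v = ι(inclX Π^tp_X̲)`,
`map_YddL_ofCoverModel`). ([IUTchII] Cor 2.4 (ii) p.70) [claim: Mochizuki2012, status: disputed] -/
theorem cuspDecomp_one_le_map_YddL_ofCoverModel_of_piTemp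
    (Cu : CuspidalInertiaData (ofCoverModel e C μ hC hS hl hp2 hpl hζ hη ι hι hinj Φ hΦ hΦK hZ hN T))
    (hchar : ∀ Q' J : Subgroup (ofCoverModel e C μ hC hS hl hp2 hpl hζ hη ι hι hinj Φ hΦ hΦK hZ hN T).Corhat,
      Cu.IsCuspidalInertia Q' J ↔ J ≤ Q' ∧ ∃ i : {x : M.Pt // M.IsCusp x} × M.GtpC,
        ∃ t ∈ (ofCoverModel e C μ hC hS hl hp2 hpl hζ hη ι hι hinj Φ hΦ hΦK hZ hN T).piPM,
          J = MulAut.conj t •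
            (((MulAut.conj i.2 • (M.toTemperedCurve.inertia i.1.1).map M.inclX) ⊓ (M.GtpXu l).map M.inclX).map
              ι.toMonoidHom :
              Subgroup (ofCoverModel e C μ hC hS hl hp2 hpl hζ hη ι hι hinj Φ hΦ hΦK hZ hN T).Corhat))
    (hX : ∀ (x : M.Pt), M.IsCusp x → ∀ (g t₁ : M.GtpC), t₁ ∈ (M.GtpXu l).map M.inclX →
      ∀ n₀ : M.PiTemp, n₀ ∈ C.Huu →
        (∀ h : M.GtpC, h ∈ (C.Huu : Subgroup M.PiTemp).map M.inclX →
          (h ∈ MulAut.conj t₁ •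
              ((MulAut.conj g • (M.toTemperedCurve.inertia x).map M.inclX) ⊓ (M.GtpXu l).map M.inclX) ↔
            M.inclX n₀ * h * (M.inclX n₀)⁻¹ ∈ MulAut.conj t₁ •
              ((MulAut.conj g • (M.toTemperedCurve.inertia x).map M.inclX) ⊓ (M.GtpXu l).map M.inclX))) →
        n₀ ∈ M.GtpYdd)
    (H : Subgroup P) :
    ∀ I : Subgroup (ofCoverModel e C μ hC hS hl hp2 hpl hζ hη ι hι hinj Φ hΦ hΦK hZ hN T).Corhat,
      Cu.IsCuspidalInertia (ofCoverModel e C μ hC hS hl hp2 hpl hζ hη ι hι hinj Φ hΦ hΦK hZ hN T).piV I →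
        I ≤ (ofCoverModel e C μ hC hS hl hp2 hpl hζ hη ι hι hinj Φ hΦ hΦK hZ hN T).deltaBox H →
          (ofCoverModel e C μ hC hS hl hp2 hpl hζ hη ι hι hinj Φ hΦ hΦK hZ hN T).cuspDecomp I 1 ≤
            (T.YddL).map ((ofCoverModel e C μ hC hS hl hp2 hpl hζ hη ι hι hinj Φ hΦ hΦK hZ hN T).emb.comp T.incl) := by
  set W := ofCoverModel e C μ hC hS hl hp2 hpl hζ hη ι hι hinj Φ hΦ hΦK hZ hN T with hW
  intro I hI _ n hn
  -- the cuspidal inertia group: `I = t · ι(J₁) · t⁻¹`, `t = ι t₁ ∈ Π^±_v = ι(inclX Π^tp_X̲)`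
  obtain ⟨-, ⟨⟨x, hx⟩, g⟩, t, ht, rfl⟩ := (hchar _ _).mp hI
  rw [piPM_ofCoverModel] at ht
  obtain ⟨t₁, ht₁, rfl⟩ := ht
  -- the element of the relative normaliser: `n = ι(inclX n₀)`, `n₀ ∈ Π^tp_X̲̲`
  rw [W.mem_cuspDecomp_iff, map_conj_one'', map_conj_one'', piV_ofCoverModel] at hn
  obtain ⟨hnV, hnN⟩ := hn
  obtain ⟨_, ⟨n₀, hn₀, rfl⟩, rfl⟩ := hnV
  -- the target
  rw [map_YddL_ofCoverModel]
  refine ⟨M.inclX n₀, ⟨n₀, ⟨?_, hn₀⟩, rfl⟩, rfl⟩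
  -- transport the normalising property through the injection `ι`
  refine hX x hx g t₁ ht₁ n₀ hn₀ fun h hh => ?_
  have hinj' : Function.Injective ι.toMonoidHom := hinj
  have key : (ι.toMonoidHom h ∈ (MulAut.conj (ι.toMonoidHom t₁) •
        (((MulAut.conj g • (M.toTemperedCurve.inertia x).map M.inclX) ⊓ (M.GtpXu l).map M.inclX).map
          ι.toMonoidHom) : Subgroup Q)) ↔
      ι.toMonoidHom (M.inclX n₀) * ι.toMonoidHom h * (ι.toMonoidHom (M.inclX n₀))⁻¹ ∈
        (MulAut.conj (ι.toMonoidHom t₁) •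
          (((MulAut.conj g • (M.toTemperedCurve.inertia x).map M.inclX) ⊓ (M.GtpXu l).map M.inclX).map
            ι.toMonoidHom) : Subgroup Q) :=
    hnN (ι.toMonoidHom h) ⟨h, hh, rfl⟩
  rw [← map_conj_smul, Subgroup.mem_map_iff_mem hinj', ← map_mul, ← map_inv, ← map_mul,
    Subgroup.mem_map_iff_mem hinj'] at key
  exact key

/-- **The [EtTh]/[SemiAnbd] half `hX`, from three named inputs at the [EtTh] μ₂-setting** ([SemiAnbd] Thm. 6.5 (ii) second
sentence «if `x` is a cusp, then `D_x = C_{Π^temp_{X_K}}(H)` for any open subgroup `H ⊆ I_x`» and (iii) «every isomorphism of tempered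
groups preserves cuspidal geometric decomposition groups», kurims p. 71–72 — the INSTANCE FORMS at `X = M.toTemperedCurve` of the
FACT-LIST rows F-1708 `TemperedDecompositionGroupsHolds` (conjunct `DecompEqCommensuratorOfOpenInertia`) and F-1704
`CuspidalAbsolutenessHolds` (`IsoPreservesCuspidalDecomp`), consumed BY NAME as hypotheses; and the cusp-splitting clause of
GAP-LEDGER G-w6d069-1 at `N = 2` under `K = K̈`: «`D_x ⊆ Π^tp_{Y₂}` for every cusp `x` of `X`», [EtTh] §1 PRIMS p. 13 «the image [of
`G_{K_N}` under the cusp section] … determines a Galois covering `Y_N → Y`», p. 17 «`Ÿ = Y₂`»).  ARGUMENT: write `t₁ = inclX t₀`,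
`m := t₀⁻¹ n₀ t₀ ∈ Π^tp_X̲̲` (`Π^tp_X̲̲ ⊴ Π^tp_X̲`); by (iii) applied to the automorphism `conjX g` of `Π^tp_X`, `g·inclX(I_x)·g⁻¹ = inclX(γ·I_{x'}·γ⁻¹)`
for a cusp `x'`; the hypothesis then says that `m` normalises `U := γ·I_{x'}·γ⁻¹ ∩ Π^tp_X̲̲`, an open subgroup of the cuspidal inertia
group `γ·I_{x'}·γ⁻¹`; by (ii) `γ⁻¹ m γ ∈ D_{x'} ⊆ Π^tp_{Y₂} = Π^tp_Ÿ`, a normal subgroup of `Π^tp_X`, whence `m`, `n₀ ∈ Π^tp_Ÿ`.  PROVED.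
[cite: MochizukiSemiAnbd2006, Thm 6.5 (ii)(iii) pp.71–72] [cite: MochizukiEtTh2009, §1 p.13] -/
theorem piTemp_hX_of_cuspClauses (e : M.CLevelData) (hS : M.toThetaSetting.Sec2Hyps)
    (hN : (C.Huu.subgroupOf (M.GtpXu l)).Normal)
    (habs : M.toTemperedCurve.IsoPreservesCuspidalDecomp M.toTemperedCurve)
    (hcomm : M.toTemperedCurve.DecompEqCommensuratorOfOpenInertia)
    (hsplit : ∀ x : M.Pt, M.IsCusp x → M.decomp x ≤ M.GtpYN 2) :
    ∀ (x : M.Pt), M.IsCusp x → ∀ (g t₁ : M.GtpC), t₁ ∈ (M.GtpXu l).map M.inclX →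
      ∀ n₀ : M.PiTemp, n₀ ∈ C.Huu →
        (∀ h : M.GtpC, h ∈ (C.Huu : Subgroup M.PiTemp).map M.inclX →
          (h ∈ MulAut.conj t₁ •
              ((MulAut.conj g • (M.toTemperedCurve.inertia x).map M.inclX) ⊓ (M.GtpXu l).map M.inclX) ↔
            M.inclX n₀ * h * (M.inclX n₀)⁻¹ ∈ MulAut.conj t₁ •
              ((MulAut.conj g • (M.toTemperedCurve.inertia x).map M.inclX) ⊓ (M.GtpXu l).map M.inclX))) →
        n₀ ∈ M.GtpYdd := by
  intro x hx g t₁ ht₁ n₀ hn₀ hnorm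
  -- `Π^tp_Ÿ = Π^tp_{Y₂}` is normal in `Π^tp_X`
  have hYdd : M.GtpYdd = M.GtpYN 2 := ThetaSetting.GtpYdd_eq_GtpYN_two hS
  haveI : M.GtpYdd.Normal := by rw [hYdd]; exact M.GtpYN_normal 2
  -- Step 1: `t₁ = inclX t₀`, `m := t₀⁻¹ n₀ t₀ ∈ Π^tp_X̲̲`
  obtain ⟨t₀, ht₀, rfl⟩ := ht₁
  have hHuuX : C.Huu ≤ M.GtpXu l := C.Huu_le_GtpXu
  have hconjHuu : ∀ a : M.PiTemp, a ∈ M.GtpXu l → ∀ b ∈ C.Huu, a * b * a⁻¹ ∈ C.Huu := by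
    intro a ha b hb
    have h := hN.conj_mem ⟨b, hHuuX hb⟩ (Subgroup.mem_subgroupOf.mpr hb) ⟨a, ha⟩
    exact Subgroup.mem_subgroupOf.mp h
  set m : M.PiTemp := t₀⁻¹ * n₀ * t₀ with hm
  have hmHuu : m ∈ C.Huu := by
    have h := hconjHuu t₀⁻¹ ((M.GtpXu l).inv_mem ht₀) n₀ hn₀
    rwa [inv_inv] at h
  -- Step 2: `g·inclX(I_x)·g⁻¹ = inclX(γ·I_{x'}·γ⁻¹)` for a cusp `x'` (cuspidal absoluteness applied to `conjX g`)
  obtain ⟨x', hx', γ, hγ⟩ := (habs (e.conjX g) (M.toTemperedCurve.inertia x)).2 ⟨x, hx, 1, (one_smul _ _).symm⟩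
  set I'' : Subgroup M.PiTemp := γ • M.toTemperedCurve.inertia x' with hI''
  have hJ : MulAut.conj g • (M.toTemperedCurve.inertia x).map M.inclX = I''.map M.inclX := by
    rw [← hγ, Subgroup.pointwise_smul_def, Subgroup.map_map, Subgroup.map_map]
    congr 1
    ext i
    change MulAut.conj g • M.inclX i = M.inclX (e.conjX g i)
    rw [MulAut.smul_def, MulAut.conj_apply, e.inclX_conjX]
  have hJ₁ : (MulAut.conj g • (M.toTemperedCurve.inertia x).map M.inclX) ⊓ (M.GtpXu l).map M.inclX =
      (I'' ⊓ M.GtpXu l).map M.inclX := by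
    rw [hJ, Subgroup.map_inf _ _ M.inclX M.injective_inclX]
  -- Step 3: `m` normalises `I''` relative to `Π^tp_X̲̲`
  have step3 : ∀ h₀ ∈ C.Huu, h₀ ∈ I'' ↔ m * h₀ * m⁻¹ ∈ I'' := by
    intro h₀ hh₀
    have hth : t₀ * h₀ * t₀⁻¹ ∈ C.Huu := hconjHuu t₀ ht₀ h₀ hh₀
    have key := hnorm (M.inclX (t₀ * h₀ * t₀⁻¹)) ⟨_, hth, rfl⟩
    rw [hJ₁] at key
    have e1 : M.inclX (t₀ * h₀ * t₀⁻¹) = MulAut.conj (M.inclX t₀) • M.inclX h₀ := by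
      rw [MulAut.smul_def, MulAut.conj_apply, map_mul, map_mul, map_inv]
    have e2 : M.inclX n₀ * M.inclX (t₀ * h₀ * t₀⁻¹) * (M.inclX n₀)⁻¹ =
        MulAut.conj (M.inclX t₀) • M.inclX (m * h₀ * m⁻¹) := by
      rw [MulAut.smul_def, MulAut.conj_apply, hm]
      simp only [← map_mul, ← map_inv]
      congr 1
      group
    rw [e2, e1, Subgroup.smul_mem_pointwise_smul_iff, Subgroup.smul_mem_pointwise_smul_iff,
      Subgroup.mem_map_iff_mem M.injective_inclX, Subgroup.mem_map_iff_mem M.injective_inclX,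
      Subgroup.mem_inf, Subgroup.mem_inf] at key
    have hh₀X : h₀ ∈ M.GtpXu l := hHuuX hh₀
    have hmh : m * h₀ * m⁻¹ ∈ M.GtpXu l := hHuuX (C.Huu.mul_mem (C.Huu.mul_mem hmHuu hh₀) (C.Huu.inv_mem hmHuu))
    simpa only [hh₀X, hmh, and_true] using key
  -- Step 4: `m` normalises the open subgroup `U := I'' ∩ Π^tp_X̲̲` of the cuspidal inertia group `I''`
  set U : Subgroup M.PiTemp := I'' ⊓ C.Huu with hU
  have hmU : ConjAct.toConjAct m • U = U := by
    apply le_antisymm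
    · intro y hy
      rw [Subgroup.mem_smul_pointwise_iff_exists] at hy
      obtain ⟨u, hu, rfl⟩ := hy
      rw [ConjAct.smul_def, ConjAct.ofConjAct_toConjAct]
      exact ⟨(step3 u hu.2).mp hu.1, C.Huu.mul_mem (C.Huu.mul_mem hmHuu hu.2) (C.Huu.inv_mem hmHuu)⟩
    · intro u hu
      rw [Subgroup.mem_smul_pointwise_iff_exists]
      have hu' : m⁻¹ * u * m ∈ C.Huu :=
        C.Huu.mul_mem (C.Huu.mul_mem (C.Huu.inv_mem hmHuu) hu.2) hmHuu
      refine ⟨m⁻¹ * u * m, ⟨(step3 _ hu').mpr ?_, hu'⟩, ?_⟩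
      · have : m * (m⁻¹ * u * m) * m⁻¹ = u := by group
        rw [this]; exact hu.1
      · rw [ConjAct.smul_def, ConjAct.ofConjAct_toConjAct]; group
  -- the same subgroup seen from `x'`: `γ⁻¹·U·γ = I_{x'} ∩ γ⁻¹·Π^tp_X̲̲·γ`, open in `I_{x'}`
  have hU' : γ⁻¹ • U = M.toTemperedCurve.inertia x' ⊓ γ⁻¹ • C.Huu := by
    rw [hU, Subgroup.smul_inf, hI'', inv_smul_smul]
  have hopen : IsOpen ((((γ⁻¹ • U).subgroupOf (M.toTemperedCurve.inertia x')) :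
      Subgroup (M.toTemperedCurve.inertia x')) : Set (M.toTemperedCurve.inertia x')) := by
    have hset : ((((γ⁻¹ • U).subgroupOf (M.toTemperedCurve.inertia x')) :
        Subgroup (M.toTemperedCurve.inertia x')) : Set (M.toTemperedCurve.inertia x')) =
        Subtype.val ⁻¹' ((γ⁻¹ • C.Huu : Subgroup M.PiTemp) : Set M.PiTemp) := by
      ext z
      rw [SetLike.mem_coe, Subgroup.mem_subgroupOf, hU', Subgroup.mem_inf, Set.mem_preimage, SetLike.mem_coe]
      exact ⟨fun h => h.2, fun h => ⟨z.2, h⟩⟩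
    rw [hset]
    exact (isOpen_conjAct_smul γ⁻¹ C.isOpen_Huu).preimage continuous_subtype_val
  have hcommU : Subgroup.Commensurable.commensurator (γ⁻¹ • U) = M.decomp x' :=
    hcomm x' hx' (γ⁻¹ • U) (hU' ▸ inf_le_left) hopen
  -- `γ⁻¹ m γ` commensurates (indeed normalises) `γ⁻¹·U·γ`, hence lies in `D_{x'}`
  have hmem : ConjAct.ofConjAct (γ⁻¹ * ConjAct.toConjAct m * γ) ∈ M.decomp x' := by
    rw [← hcommU, Subgroup.Commensurable.commensurator_mem_iff, ConjAct.toConjAct_ofConjAct, mul_smul, mul_smul,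
      smul_inv_smul, hmU]
  -- `D_{x'} ⊆ Π^tp_{Y₂} = Π^tp_Ÿ ⊴ Π^tp_X`: conjugate back
  have hm' : (ConjAct.ofConjAct γ)⁻¹ * m * ConjAct.ofConjAct γ ∈ M.GtpYdd := by
    have h : ConjAct.ofConjAct (γ⁻¹ * ConjAct.toConjAct m * γ) ∈ M.GtpYdd := by
      rw [hYdd]; exact hsplit x' hx' hmem
    simpa [ConjAct.ofConjAct_mul, ConjAct.ofConjAct_inv, ConjAct.ofConjAct_toConjAct] using h
  have hmYdd : m ∈ M.GtpYdd := by
    have h := ‹M.GtpYdd.Normal›.conj_mem _ hm' (ConjAct.ofConjAct γ)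
    have : ConjAct.ofConjAct γ * ((ConjAct.ofConjAct γ)⁻¹ * m * ConjAct.ofConjAct γ) * (ConjAct.ofConjAct γ)⁻¹ = m := by
      group
    rwa [this] at h
  have h := ‹M.GtpYdd.Normal›.conj_mem _ hmYdd t₀
  have : t₀ * m * t₀⁻¹ = n₀ := by rw [hm]; group
  rwa [this] at h

/-- **IUTchII:Cor2.4(ii)** (a), sub-node **(a.2) "`D_t ⊆ Π^tp_{Ÿ̲_v}`" AT THE GENUINE `±`-TOWER — DISCHARGED MODULO NAMED [SemiAnbd]/[EtTh]
INPUTS** (kurims p. 70 l. 34–42): for the cuspidal-inertia datum `Cu` of abc-iut-w5-d132's B13-GENUINE characterisation on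
`W := PlusMinusTower.ofCoverModel …`, the binder `hYdd` of every landed closer of `Cor24_ii_iii'` (`cor24_ii_iii'_of_inputs`, …,
`cor24_ii_iii'_of_levels_byName`) HOLDS, given — as hypotheses, by name — the instance forms at `X` of [SemiAnbd] Thm. 6.5 (ii)
(`DecompEqCommensuratorOfOpenInertia`, FACT-LIST F-1708) and (iii) (`IsoPreservesCuspidalDecomp`, F-1704), and the cusp-splitting clause
«`D_x ⊆ Π^tp_{Y₂}`» (GAP-LEDGER G-w6d069-1 at `N = 2`, `K = K̈`).  PROVED (`cuspDecomp_one_le_map_YddL_ofCoverModel_of_piTemp` ∘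
`piTemp_hX_of_cuspClauses`).  With abc-iut-w5-d184's `cuspDecomp_one_le_box_of_cor24_i` (a.1) this leaves, at the genuine tower, NO
anonymous binder in clause (a) of Cor. 2.4 (ii): everything is a node (Cor. 2.4 (i)), a junction law ((S), (E)), a frozen fact (F-1704,
F-1708) or the one printed clause G-w6d069-1. [claim: Mochizuki2012, status: disputed] -/
theorem cuspDecomp_one_le_map_YddL_ofCoverModel
    (Cu : CuspidalInertiaData (ofCoverModel e C μ hC hS hl hp2 hpl hζ hη ι hι hinj Φ hΦ hΦK hZ hN T))
    (hchar : ∀ Q' J : Subgroup (ofCoverModel e C μ hC hS hl hp2 hpl hζ hη ι hι hinj Φ hΦ hΦK hZ hN T).Corhat,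
      Cu.IsCuspidalInertia Q' J ↔ J ≤ Q' ∧ ∃ i : {x : M.Pt // M.IsCusp x} × M.GtpC,
        ∃ t ∈ (ofCoverModel e C μ hC hS hl hp2 hpl hζ hη ι hι hinj Φ hΦ hΦK hZ hN T).piPM,
          J = MulAut.conj t •
            (((MulAut.conj i.2 • (M.toTemperedCurve.inertia i.1.1).map M.inclX) ⊓ (M.GtpXu l).map M.inclX).map
              ι.toMonoidHom :
              Subgroup (ofCoverModel e C μ hC hS hl hp2 hpl hζ hη ι hι hinj Φ hΦ hΦK hZ hN T).Corhat))
    (habs : M.toTemperedCurve.IsoPreservesCuspidalDecomp M.toTemperedCurve)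
    (hcomm : M.toTemperedCurve.DecompEqCommensuratorOfOpenInertia)
    (hsplit : ∀ x : M.Pt, M.IsCusp x → M.decomp x ≤ M.GtpYN 2) (H : Subgroup P) :
    ∀ I : Subgroup (ofCoverModel e C μ hC hS hl hp2 hpl hζ hη ι hι hinj Φ hΦ hΦK hZ hN T).Corhat,
      Cu.IsCuspidalInertia (ofCoverModel e C μ hC hS hl hp2 hpl hζ hη ι hι hinj Φ hΦ hΦK hZ hN T).piV I →
        I ≤ (ofCoverModel e C μ hC hS hl hp2 hpl hζ hη ι hι hinj Φ hΦ hΦK hZ hN T).deltaBox H →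
          (ofCoverModel e C μ hC hS hl hp2 hpl hζ hη ι hι hinj Φ hΦ hΦK hZ hN T).cuspDecomp I 1 ≤
            (T.YddL).map ((ofCoverModel e C μ hC hS hl hp2 hpl hζ hη ι hι hinj Φ hΦ hΦK hZ hN T).emb.comp T.incl) :=
  cuspDecomp_one_le_map_YddL_ofCoverModel_of_piTemp e C μ hC hS hl hp2 hpl hζ hη ι hι hinj Φ hΦ hΦK hZ hN T Cu hchar
    (piTemp_hX_of_cuspClauses (C := C) e hS hN habs hcomm hsplit) H

end PlusMinusTower

/-! ### v2 (append-only): the cusp-splitting clause in its PRINTED, `N`-indexed form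

The origin clause requested in GAP-LEDGER G-w6d069-1 is naturally typed for ALL levels `N` ([EtTh] §1 PRIMS p. 13: for every
`N ≥ 1`, `Y_N → Y` is cut out by the image of `G_{K_N}` under the cusp section): «`D_x ∩ aug⁻¹(G_{K_N}) ⊆ Π^tp_{Y_N}` for every cusp
`x` of `X` and every `N`».  At the μ₂-setting (`K = K̈`, field `sqrtqX_mem_K`; `G_{K₂} = G_K̈ = G_K`, abc-iut-L2's
`ThetaSetting.Sec2Hyps.GKdd_eq`) its `N = 2` instance is exactly the hypothesis `hsplit` used above, so the assembly is restated with
the printed `N`-indexed clause as its ONLY [EtTh]-side input besides the two [SemiAnbd] facts. -/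

namespace PlusMinusTower

variable {p : ℕ} [Fact p.Prime] {M : MuTwoSetting p} (e : M.CLevelData)
  {E : M.toThetaSetting.EtaleThetaData} {l : ℕ} (C : E.DoubleUnderline l) {N : ℕ+}
  (μ : M.toThetaSetting.CyclotomeMod l N) (hC : M.toThetaSetting.Compat) (hS : M.toThetaSetting.Sec2Hyps)
  (hl : l.Prime) (hp2 : p ≠ 2) (hpl : p ≠ l) (hζ : ∃ ζ : M.toThetaSetting.K, IsPrimitiveRoot ζ (4 * l))
  {η : (C.thetaEnvData μ hC hS).PiYdd → MuN p N} (hη : η ∈ (C.thetaEnvData μ hC hS).thetaCocycles)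
  {Q : Type} [Group Q] [TopologicalSpace Q] [IsTopologicalGroup Q]
  (ι : M.GtpC →ₜ* Q) (hι : IsProfiniteCompletion ι) (hinj : Function.Injective ι)
  (Φ : Q →* GQp p) (hΦ : ∀ g : M.GtpC, Φ (ι g) = e.augC g) (hΦK : Φ.range = M.GK)
  (hZ : Thm16Sub.KerToZIsCompactlyGenerated M.toThetaSetting) (hN : (C.Huu.subgroupOf (M.GtpXu l)).Normal)
  {P : TopGroup.{0}} (T : TemperedCoverings (BadPlaceSetting.ofUnderline C μ hC hS hl hp2 hpl hζ hη) P)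

/-- **The printed `N`-indexed cusp-splitting clause specialises to `hsplit` at `N = 2` under `K = K̈`** ([EtTh] §1 PRIMS p. 13
«the image [of `G_{K_N}`] … determines a Galois covering `Y_N → Y`», p. 17 «`K̈ = K₂`», Def. 2.5 p. 39 `K = K̈`): if
`D_x ∩ aug⁻¹(G_{K_N}) ⊆ Π^tp_{Y_N}` for every cusp `x` and every `N`, then `D_x ⊆ Π^tp_{Y₂}` — since `aug(Π^tp_X) = G_K = G_{K₂}`
(`ThetaSetting.aug_mem_GK`, `ThetaSetting.Sec2Hyps.GKdd_eq`).  PROVED. [cite: MochizukiEtTh2009, §1 p.13] -/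
theorem decomp_le_GtpYN_two_of_cuspSection (hS : M.toThetaSetting.Sec2Hyps)
    (hcusp : ∀ x : M.Pt, M.IsCusp x → ∀ N' : ℕ+,
      M.decomp x ⊓ (M.GKN N').comap M.aug.toMonoidHom ≤ M.GtpYN N') :
    ∀ x : M.Pt, M.IsCusp x → M.decomp x ≤ M.GtpYN 2 := by
  intro x hx g hg
  have hGK : M.aug.toMonoidHom g ∈ M.GK := ThetaSetting.aug_mem_GK M.toThetaSetting g
  have h2 : M.GKN 2 = M.GK := ThetaSetting.Sec2Hyps.GKdd_eq hS
  have hg2 : g ∈ (M.GKN 2).comap M.aug.toMonoidHom := by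
    rw [Subgroup.mem_comap, h2]
    exact hGK
  exact hcusp x hx 2 (Subgroup.mem_inf.mpr ⟨hg, hg2⟩)

/-- **IUTchII:Cor2.4(ii)** (a), sub-node (a.2) AT THE GENUINE `±`-TOWER, with the cusp-splitting input in its PRINTED `N`-indexed
form (kurims p. 70 l. 34–42; [EtTh] §1 PRIMS p. 13): the binder `hYdd` of the node's closers holds at `W := ofCoverModel …` for the
B13-GENUINE cusp datum, given — by name, as hypotheses — the instance forms at `X` of [SemiAnbd] Thm. 6.5 (iii) (F-1704) and (ii)
(F-1708) and the origin clause «`D_x ∩ aug⁻¹(G_{K_N}) ⊆ Π^tp_{Y_N}` for every cusp `x`, every `N`» (GAP-LEDGER G-w6d069-1, verbatim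
shape).  PROVED (`cuspDecomp_one_le_map_YddL_ofCoverModel` ∘ `decomp_le_GtpYN_two_of_cuspSection`). [claim: Mochizuki2012, status: disputed] -/
theorem cuspDecomp_one_le_map_YddL_ofCoverModel_of_cuspSection
    (Cu : CuspidalInertiaData (ofCoverModel e C μ hC hS hl hp2 hpl hζ hη ι hι hinj Φ hΦ hΦK hZ hN T))
    (hchar : ∀ Q' J : Subgroup (ofCoverModel e C μ hC hS hl hp2 hpl hζ hη ι hι hinj Φ hΦ hΦK hZ hN T).Corhat,
      Cu.IsCuspidalInertia Q' J ↔ J ≤ Q' ∧ ∃ i : {x : M.Pt // M.IsCusp x} × M.GtpC,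
        ∃ t ∈ (ofCoverModel e C μ hC hS hl hp2 hpl hζ hη ι hι hinj Φ hΦ hΦK hZ hN T).piPM,
          J = MulAut.conj t •
            (((MulAut.conj i.2 • (M.toTemperedCurve.inertia i.1.1).map M.inclX) ⊓ (M.GtpXu l).map M.inclX).map
              ι.toMonoidHom :
              Subgroup (ofCoverModel e C μ hC hS hl hp2 hpl hζ hη ι hι hinj Φ hΦ hΦK hZ hN T).Corhat))
    (habs : M.toTemperedCurve.IsoPreservesCuspidalDecomp M.toTemperedCurve)
    (hcomm : M.toTemperedCurve.DecompEqCommensuratorOfOpenInertia)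
    (hcusp : ∀ x : M.Pt, M.IsCusp x → ∀ N' : ℕ+,
      M.decomp x ⊓ (M.GKN N').comap M.aug.toMonoidHom ≤ M.GtpYN N')
    (H : Subgroup P) :
    ∀ I : Subgroup (ofCoverModel e C μ hC hS hl hp2 hpl hζ hη ι hι hinj Φ hΦ hΦK hZ hN T).Corhat,
      Cu.IsCuspidalInertia (ofCoverModel e C μ hC hS hl hp2 hpl hζ hη ι hι hinj Φ hΦ hΦK hZ hN T).piV I →
        I ≤ (ofCoverModel e C μ hC hS hl hp2 hpl hζ hη ι hι hinj Φ hΦ hΦK hZ hN T).deltaBox H →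
          (ofCoverModel e C μ hC hS hl hp2 hpl hζ hη ι hι hinj Φ hΦ hΦK hZ hN T).cuspDecomp I 1 ≤
            (T.YddL).map ((ofCoverModel e C μ hC hS hl hp2 hpl hζ hη ι hι hinj Φ hΦ hΦK hZ hN T).emb.comp T.incl) :=
  cuspDecomp_one_le_map_YddL_ofCoverModel e C μ hC hS hl hp2 hpl hζ hη ι hι hinj Φ hΦ hΦK hZ hN T Cu hchar habs hcomm
    (decomp_le_GtpYN_two_of_cuspSection hS hcusp) H

end PlusMinusTower

end Literature.IUT.HodgeArakelov

end
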